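import HarnessLib
import Summits.HodgeConjecture.Statement
import Literature.AlgebraicGeometry.Motives.Varieties
import Literature.AlgebraicGeometry.Motives.Sweep1
import Literature.AlgebraicGeometry.Motives.HodgeTensor
import Literature.AlgebraicGeometry.Motives.HodgeTensorFactsHolds
import Literature.AlgebraicGeometry.Motives.FamiliesVHS
import Literature.AlgebraicGeometry.HodgeTheory.HodgeConjecture
import Literature.AlgebraicGeometry.HodgeTheory.BettiUniverseAxioms
import Literature.AlgebraicGeometry.HodgeTheory.ComplexConjugationHolds
import Literature.AlgebraicGeometry.HodgeTheory.LefschetzOneOne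
import Literature.AlgebraicGeometry.HodgeTheory.AlgebraicMonodromyMumfordTate
import Literature.AlgebraicGeometry.HodgeTheory.FibrewiseDeckRelations
import Literature.AlgebraicGeometry.HodgeTheory.QuaternionicQuarticCover
import Literature.AlgebraicGeometry.HodgeTheory.QuaternionicQuarticFamily
import Literature.AlgebraicGeometry.HodgeTheory.QuaternionicQuarticDeckChart
import Literature.AlgebraicGeometry.HodgeTheory.QuaternionicQuarticDeckChartAction
import Literature.Algebra.Lie.KatzRecognitionTheorems
import Literature.Algebra.Lie.KatzRecognitionAddenda
import Literature.AlgebraicGeometry.HodgeTheory.DeligneMonodromySemisimple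
import Literature.AlgebraicGeometry.Resolution.FunctorialResolutionAutomorphisms
import Summits.HodgeConjecture.HodgeConjecture.Theses.Q8SymplecticPowers
import Summits.HodgeConjecture.HodgeConjecture.Theorems.Q8SymplecticPowersTransportRestrictionCurrency
import Summits.HodgeConjecture.HodgeConjecture.Theorems.Q8SymplecticPowersMonodromyDeckCommutes
import Summits.HodgeConjecture.HodgeConjecture.Theorems.Q8SymplecticPowersCommKernel
import Summits.HodgeConjecture.HodgeConjecture.Theorems.Q8SymplecticPowersInvariantPartFiniteOrbit
import Summits.HodgeConjecture.HodgeConjecture.Theorems.Q8SymplecticPowersFiniteOrbitPartHodge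
import Summits.HodgeConjecture.HodgeConjecture.Theorems.Q8SymplecticPowersFiniteOrbitPartNondegenerate
import Summits.HodgeConjecture.HodgeConjecture.Theorems.Q8SymplecticPowersFibreBirational
import Summits.HodgeConjecture.HodgeConjecture.Theorems.Q8SymplecticPowersGenericityPolynomials
import Summits.HodgeConjecture.HodgeConjecture.Theorems.Q8SymplecticPowersStubTransportHeredityQ6
import Literature.AlgebraicGeometry.HodgeTheory.AlgebraicMonodromyMumfordTateOfQuasiProjective
import Literature.AlgebraicGeometry.HodgeTheory.MonodromySemisimpleSubvariations
import Literature.AlgebraicGeometry.HodgeTheory.DirectImageBaseChangeSections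
import Literature.AlgebraicGeometry.HodgeTheory.CyclicCoverReflectionMonodromy
import Literature.AlgebraicGeometry.HodgeTheory.BettiUniverseTracePairing
import Summits.HodgeConjecture.HodgeConjecture.Theorems.Q8SymplecticPowersDeckIsometry
import Literature.AlgebraicGeometry.HodgeTheory.QuaternionicQuarticPrimeSpecialisation

/-!
# Route `Q8SymplecticPowers`, crux K1Q «mechanism-v9» — registered stub S7⁺ `stub_transportHeredityQ9` (TRANSPORT ∕ HEREDITY,
# existential antecedent), v9 SIGNATURE VERBATIM

Crux K1Q `VeryGeneralQuaternionCommutatorsInHg` (stmt-HodgeConjecture-24190), skeleton «mechanism-v9» (planner p3 g37, sha256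
39dcae31…; S7⁺ header l.74–75 reproduced VERBATIM below). Prover seat `hodge-nonav-19716-p2` (g14).

v9 RE-PACKAGING (p3, 2026-08-29 15:22Z): the ∀-model stubs S4 (with (iv)) and S5 were retired as misstated (equivariant boundary blow-ups
violate (iv)); they are replaced by ONE existential stub S9 `stub_certifiedDeckFamilyQ` — «there is a deck family (S6 clauses) carrying the
S4-v6 and S5-v6 bodies at every member» — and S7 becomes S7⁺: Katz's four recognition facts → the Cattani–Deligne–Kaplan cover → Deligne's
semisimplicity → Deligne 1987 Prop. 1.13 → S2 (G-AUT-BIR) → the S9-shaped existential (without its Kollár prefix) → the commutator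
conjunct of K1Q for every even `e ≥ 4`.

PROOF = the telescope of the retired S7 file (`Q8SymplecticPowersStubTransportHeredityQ`, p724413), run on the one family handed over
by the antecedent: `R² π_* ℂ` is a local system; the base is irreducible; CDK gives countably many proper Zariski-closed `W_j` containing
the non-Hodge-generic points; the GENERICITY POLYNOMIALS come from `exists_genericityPolynomials` (G7, coset device); at an admissible
pair off all `Z(G_i)` we get a Hodge-generic point `t` with `G_e(a(t)) ≠ 0` and `X_t ~bir V_(c,ψ)` (`birationalOver_fiberOver_of_deckClauses`,
G8). At `t`: DENSITY via `mem_glIdentityComponent_of_variablePart` (B3) fed by G1–G5, `nondegenerate_tr_cup`, `cup_comm_of_even`, the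
deck isometries, S4 (o′)(ii)(iii) and S5 — the S5 body being moved from the local currency `ker(A²+1) ⊗ ℂ` (v6) to the `Mv`-currency
(`Mv = ker(A²+1)`, from S4 (iv) and the isometry: `Q8SymplecticPowersStubTransportHeredityQ6.eigenspace_sq_neg_one_inf_orthogonal_eq`); `Mon_t ⊆ MT(H²(X_t))` at the Hodge-generic
`t` and prover-Ax's K1 kernel give `Comm(X_t, τ_t, j_t)`; the deck-pair binders at `t`; S2 transports `Comm` to the arbitrary model.

HONEST FRAMING: closes the REGISTERED STUB S7⁺ (v9 signature) modulo by-name keying in the skeleton (the registry truncates long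
signatures; p3 keys `l.74–76 := this decl` in v10); conditional on exactly its registered binders (print facts = S8; S2 proved by Bx;
S9 open). K1Q is NOT proved (S1, S9, S8 open); HC ∕ HC_AV NOT proved; no ladder rung moves.
-/

set_option linter.dupNamespace false
set_option maxHeartbeats 800000

namespace Summit.HodgeConjecture.HodgeConjecture.Theorems.Q8SymplecticPowersStubTransportHeredityQ9

open Summit.HodgeConjecture.HodgeConjecture.Theses.Q8SymplecticPowers (VeryGeneralQuaternionCommutatorsInHg)
open CategoryTheory CategoryTheory.Limits AlgebraicGeometry
open Literature.AlgebraicGeometry.Motives Literature.AlgebraicGeometry.HodgeTheory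
open Literature.AlgebraicGeometry.HodgeTheory.BettiUniverse Literature.AlgebraicGeometry.HodgeTheory.Q8Family

/-- **S7⁺ `stub_transportHeredityQ9` (TRANSPORT ∕ HEREDITY, existential antecedent) — the registered v9 signature, proved.** The
telescope of p724413 run on the ONE certified deck family handed over by the S9-shaped antecedent (which also hands over the S4-v6 and
S5-v6 bodies at every member of that family); the S5 body is moved from the local currency `ker(A²+1) ⊗ ℂ` to the `Mv`-currency of the
restriction theorem by `Mv = ker(A²+1)` (from S4 (iv) and the deck isometry). See the module docstring for the telescope.
[cite: CarlsonMullerStachPeters2017, §15.3; Deligne1972, §5; Katz1990, Thm 1.4–1.5] -/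
theorem stub_transportHeredityQ9 :
    open Literature.AlgebraicGeometry.Motives Literature.AlgebraicGeometry.HodgeTheory Literature.AlgebraicGeometry.HodgeTheory.BettiUniverse Literature.AlgebraicGeometry.HodgeTheory.Q8Family Literature.AlgebraicGeometry.RelativeSpec Literature.AlgebraicGeometry.RelativeSpec.ActionOver Literature.Algebra.Lie Literature.Algebra.Lie.KatzRecognition CategoryTheory CategoryTheory.Limits MonoidalCategory CartesianMonoidalCategory AlgebraicGeometry in Katz1990_thm14_gabber_of_ne → Katz1990_thm14_gabber_dim8 → Katz1990_thm15_pseudoreflection → Katz1990_rmk141_nonsimple → cmsp_nonHodgeGenericPoints_countable_algebraic_cover → Deligne1971_monodromy_semisimple → Literature.AlgebraicGeometry.HodgeTheory.deligne1987_monodromy_directSum_irreducible_subvariations → (let Uni : (X : SchemeOver ℂ) → IsSmoothProjective 2 X → (X ⟶ X) → (X ⟶ X) → (bettiCohomology X 2 ≃ₗ[ℚ] bettiCohomology X 2) → Prop := fun X hX τ j g => (∀ x, g (pull τ 2 x) = pull τ 2 (g x)) ∧ (∀ x, g (pull j 2 x) = pull j 2 (g x)) ∧ (∀ x y, tr hX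 (2 + 2) (cup X 2 2 (g x) (g y)) = tr hX (2 + 2) (cup X 2 2 x y)) ∧ ∀ x ∈ (hodge exists_isReal_hodgeModel_holds hX 2).hodgeClasses 1, g x = x; let Comm : (X : SchemeOver ℂ) → IsSmoothProjective 2 X → (X ⟶ X) → (X ⟶ X) → Prop := fun X hX τ j => haveI := finite hX 2; haveI : HodgeTensorFacts.{0, 0} := hodgeTensorFacts_holds; ∀ g h : bettiCohomology X 2 ≃ₗ[ℚ] bettiCohomology X 2, Uni X hX τ j g → Uni X hX τ j h → g * h * g⁻¹ * h⁻¹ ∈ (hodge exists_isReal_hodgeModel_holds hX 2).hodgeGroup; ∀ ⦃X X' : SchemeOver ℂ⦄ (hX : IsSmoothProjective 2 X) (hX' : IsSmoothProjective 2 X'), AlgebraicGeometry.Scheme.BirationalOver X.hom X'.hom → ∀ (τ j : X ⟶ X) (τ' j' : X' ⟶ X'), (pull τ 2 ^ 4 = 1 ∧ pull j 2 ^ 2 = pull τ 2 ^ 2 ∧ pull j 2 * pull τ 2 = pull τ 2 ^ 3 * pull j 2 ∧ Module.finrank ℂ ↥(Module.End.eigenspace ((pull τ 2 ^ 2).baseChange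 ℂ) 1 ⊓ (hodge exists_isReal_hodgeModel_holds hX 2).piece 2 0) = 0 ∧ 0 < Module.finrank ℂ ↥(Module.End.eigenspace ((pull τ 2 ^ 2).baseChange ℂ) (-1) ⊓ (hodge exists_isReal_hodgeModel_holds hX 2).piece 2 0)) → (pull τ' 2 ^ 4 = 1 ∧ pull j' 2 ^ 2 = pull τ' 2 ^ 2 ∧ pull j' 2 * pull τ' 2 = pull τ' 2 ^ 3 * pull j' 2 ∧ Module.finrank ℂ ↥(Module.End.eigenspace ((pull τ' 2 ^ 2).baseChange ℂ) 1 ⊓ (hodge exists_isReal_hodgeModel_holds hX' 2).piece 2 0) = 0 ∧ 0 < Module.finrank ℂ ↥(Module.End.eigenspace ((pull τ' 2 ^ 2).baseChange ℂ) (-1) ⊓ (hodge exists_isReal_hodgeModel_holds hX' 2).piece 2 0)) → Comm X hX τ j → Comm X' hX' τ' j') → (∀ ⦃e : ℕ⦄, Even e → 4 ≤ e → ∃ (W : (Spec (.of (ParamRing e))).Opens) (𝒳 : SchemeOver ℂ) (π : 𝒳 ⟶ base W) (τ j : 𝒳 ⟶ 𝒳) (ι : (deckChart (fun i => (MvPolynomial.X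 i : ParamRing e)) ⊗ Over.mk W.ι).left ⟶ 𝒳.left), ∃ (_ : Nonempty (ComplexPoints (base W))) (hπ : IsSmoothProjectiveFamily π 2) (_ : IsQuasiProjectiveOver 𝒳) (_ : IsQuasiProjectiveOver (base W)) (_ : AlgebraicGeometry.SmoothOfRelativeDimension (Fintype.card (CIdx e)) (base W).hom) (hτπ : τ ≫ π = π) (hjπ : j ≫ π = π) (_ : τ ≫ τ ≫ τ ≫ τ = 𝟙 𝒳) (_ : j ≫ j = τ ≫ τ) (_ : τ ≫ j ≫ τ = j) (_ : IsOpenImmersion ι) (_ : ι ≫ π.left = (snd (deckChart (fun i => (MvPolynomial.X i : ParamRing e))) (Over.mk W.ι)).left) (_ : ((Over.isoMk ((deckAction (fun i => (MvPolynomial.X i : ParamRing e))).aut (QuaternionGroup.a 1)) ((deckAction (fun i => (MvPolynomial.X i : ParamRing e))).aut_comp (QuaternionGroup.a 1))).hom ▷ Over.mk W.ι).left ≫ ι = ι ≫ τ.left) (_ : ((Over.isoMk ((deckAction (fun i => (MvPolynomial.X i : ParamRing e))).aut (QuaternionGroup.xa 0)) ((deckAction (fun i => (MvPolynomial.X i :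 ParamRing e))).aut_comp (QuaternionGroup.xa 0))).hom ▷ Over.mk W.ι).left ≫ ι = ι ≫ j.left) (_ : Function.Surjective (snd (deckChart (fun i => (MvPolynomial.X i : ParamRing e))) (Over.mk W.ι)).left), ∀ (hU : IsCohomologicallyLocallyTrivialOn π Set.univ), (∀ s : ComplexPoints (base W), let Xs := fiberOver π s; let hXs : IsSmoothProjective 2 Xs := hπ.isSmoothProjective s; let A : bettiCohomology Xs 2 →ₗ[ℚ] bettiCohomology Xs 2 := pull (fiberOverEnd π τ hτπ s) 2; let Qf : LinearMap.BilinForm ℚ (bettiCohomology Xs 2) := LinearMap.compr₂ (cup Xs 2 2) (tr hXs (2 + 2)); let Γ := ratMonodromyGroup π 2 hU ⟨s, Set.mem_univ s⟩; let N : Submodule ℚ (bettiCohomology Xs 2) := Submodule.span ℚ {x | ∃ Γ' : Subgroup (bettiCohomology Xs 2 ≃ₗ[ℚ] bettiCohomology Xs 2), Γ' ≤ Γ ∧ (Γ'.subgroupOf Γ).FiniteIndex ∧ ∀ γ ∈ Γ', γ x = x}; let Mv : Submodule ℚ (bettiCohomology Xs 2) := Module.End.eigenspace (A ^ 2) (-1)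 ⊓ Qf.orthogonal N; let Miv : Submodule ℂ (TensorProduct ℚ ℂ (bettiCohomology Xs 2)) := Mv.baseChange ℂ ⊓ Module.End.eigenspace (A.baseChange ℂ) Complex.I; Module.finrank ℂ ↥(Module.End.eigenspace ((A ^ 2).baseChange ℂ) 1 ⊓ (hodge exists_isReal_hodgeModel_holds hXs 2).piece 2 0) = 0 ∧ 0 < Module.finrank ℂ ↥(Module.End.eigenspace ((A ^ 2).baseChange ℂ) (-1) ⊓ (hodge exists_isReal_hodgeModel_holds hXs 2).piece 2 0) ∧ (N.baseChange ℂ ⊓ (hodge exists_isReal_hodgeModel_holds hXs 2).piece 2 0 = ⊥) ∧ 6 ≤ Module.finrank ℂ Miv ∧ (∀ Γ' : Subgroup (bettiCohomology Xs 2 ≃ₗ[ℚ] bettiCohomology Xs 2), Γ' ≤ Γ → (Γ'.subgroupOf Γ).FiniteIndex → ∀ F : Submodule ℂ (TensorProduct ℚ ℂ (bettiCohomology Xs 2)), F ≤ Miv → (∀ γ ∈ Γ', ∀ x ∈ F, (γ.toLinearMap.baseChange ℂ) x ∈ F) → F = ⊥ ∨ F = Miv) ∧ N ≤ Module.End.eigenspace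 (A ^ 2) 1) ∧ (∀ s : ComplexPoints (base W), let Xs := fiberOver π s; let hXs : IsSmoothProjective 2 Xs := hπ.isSmoothProjective s; let A : bettiCohomology Xs 2 →ₗ[ℚ] bettiCohomology Xs 2 := pull (fiberOverEnd π τ hτπ s) 2; let B : bettiCohomology Xs 2 →ₗ[ℚ] bettiCohomology Xs 2 := pull (fiberOverEnd π j hjπ s) 2; let Qf : LinearMap.BilinForm ℚ (bettiCohomology Xs 2) := LinearMap.compr₂ (cup Xs 2 2) (tr hXs (2 + 2)); let Γ := ratMonodromyGroup π 2 hU ⟨s, Set.mem_univ s⟩; ∃ γ ∈ Γ, ∃ ℓp ℓm : TensorProduct ℚ ℂ (bettiCohomology Xs 2), ℓp ∈ (Module.End.eigenspace (A ^ 2) (-1)).baseChange ℂ ∧ ℓm ∈ (Module.End.eigenspace (A ^ 2) (-1)).baseChange ℂ ∧ A.baseChange ℂ ℓp = Complex.I • ℓp ∧ A.baseChange ℂ ℓm = Complex.I • ℓm ∧ (Qf.baseChange ℂ) ℓp (B.baseChange ℂ ℓm) ≠ 0 ∧ (γ.toLinearMap.baseChange ℂ) ℓp = Complex.I • ℓp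 ∧ (γ.toLinearMap.baseChange ℂ) ℓm = (-Complex.I) • ℓm ∧ ∀ x ∈ (Module.End.eigenspace (A ^ 2) (-1)).baseChange ℂ, A.baseChange ℂ x = Complex.I • x → (Qf.baseChange ℂ) x (B.baseChange ℂ ℓp) = 0 → (Qf.baseChange ℂ) x (B.baseChange ℂ ℓm) = 0 → (γ.toLinearMap.baseChange ℂ) x = x)) → let Uni : (X : SchemeOver ℂ) → IsSmoothProjective 2 X → (X ⟶ X) → (X ⟶ X) → (bettiCohomology X 2 ≃ₗ[ℚ] bettiCohomology X 2) → Prop := fun X hX τ j g => (∀ x, g (pull τ 2 x) = pull τ 2 (g x)) ∧ (∀ x, g (pull j 2 x) = pull j 2 (g x)) ∧ (∀ x y, tr hX (2 + 2) (cup X 2 2 (g x) (g y)) = tr hX (2 + 2) (cup X 2 2 x y)) ∧ ∀ x ∈ (hodge exists_isReal_hodgeModel_holds hX 2).hodgeClasses 1, g x = x; let Comm : (X : SchemeOver ℂ) → IsSmoothProjective 2 X → (X ⟶ X) → (X ⟶ X) → Prop := fun X hX τ j => haveI := finite hX 2; haveI : HodgeTensorFacts.{0, 0} := hodgeTensorFacts_holds;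 ∀ g h : bettiCohomology X 2 ≃ₗ[ℚ] bettiCohomology X 2, Uni X hX τ j g → Uni X hX τ j h → g * h * g⁻¹ * h⁻¹ ∈ (hodge exists_isReal_hodgeModel_holds hX 2).hodgeGroup; ∀ ⦃e : ℕ⦄, Even e → 4 ≤ e → ∃ G : ℕ → MvPolynomial ({d : Fin 3 →₀ ℕ // d.degree = 1} ⊕ {d : Fin 3 →₀ ℕ // d.degree = e - 1}) ℂ, (∀ i, ∃ c ψ : MvPolynomial (Fin 3) ℂ, c.IsHomogeneous 1 ∧ ψ.IsHomogeneous (e - 1) ∧ MvPolynomial.rename (Equiv.swap (0 : Fin 3) 1) ψ = ψ ∧ MvPolynomial.eval (Sum.elim (fun d => c.coeff d.1) (fun d => ψ.coeff d.1)) (G i) ≠ 0) ∧ ∀ c ψ : MvPolynomial (Fin 3) ℂ, c.IsHomogeneous 1 → ψ.IsHomogeneous (e - 1) → MvPolynomial.rename (Equiv.swap (0 : Fin 3) 1) ψ = ψ → (∀ i, MvPolynomial.eval (Sum.elim (fun d => c.coeff d.1) (fun d => ψ.coeff d.1)) (G i) ≠ 0) → ∀ ⦃V X : SchemeOver ℂ⦄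 (hX : IsSmoothProjective 2 X), IsHypersurfaceCutOutBy 3 (MvPolynomial.X (Fin.last 3) ^ 4 * MvPolynomial.X (Fin.castSucc 2) ^ (2 * e) - MvPolynomial.rename Fin.castSucc (c * MvPolynomial.rename (Equiv.swap (0 : Fin 3) 1) c ^ 3 * ((MvPolynomial.X 0 - MvPolynomial.X 1) * ψ) ^ 2)) V → AlgebraicGeometry.Scheme.BirationalOver X.hom V.hom → ∀ τ j : X ⟶ X, (pull τ 2 ^ 4 = 1 ∧ pull j 2 ^ 2 = pull τ 2 ^ 2 ∧ pull j 2 * pull τ 2 = pull τ 2 ^ 3 * pull j 2 ∧ Module.finrank ℂ ↥(Module.End.eigenspace ((pull τ 2 ^ 2).baseChange ℂ) 1 ⊓ (hodge exists_isReal_hodgeModel_holds hX 2).piece 2 0) = 0 ∧ 0 < Module.finrank ℂ ↥(Module.End.eigenspace ((pull τ 2 ^ 2).baseChange ℂ) (-1) ⊓ (hodge exists_isReal_hodgeModel_holds hX 2).piece 2 0)) → Comm X hX τ j := by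
  intro h14 h14' h15 h141 hCDK hDel hDelB hS2 hS9 Uni Comm e he h4
  obtain ⟨W, 𝒳, π, τ, j, ι, hne, hπ, hqp, hqpW, hsm, hτπ, hjπ, hτ4, hj2, hτjτ, hιo, hιπ, hιτ, hιj, hsurj, h45⟩ :=
    hS9 he h4
  -- ### base facts of the family
  haveI := hsm
  haveI : AlgebraicGeometry.Smooth (base W).hom :=
    AlgebraicGeometry.SmoothOfRelativeDimension.smooth (Fintype.card (CIdx e)) (base W).hom
  have hU : IsCohomologicallyLocallyTrivialOn π (Set.univ : Set (ComplexPoints (base W))) :=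
    isCohomologicallyLocallyTrivialOn_univ_of_isSmoothProjectiveFamily_of_smooth π hπ
  obtain ⟨h4all, h5all⟩ := h45 hU
  haveI : HodgeTensorFacts.{0, 0} := hodgeTensorFacts_holds
  haveI hfin : ∀ t : ComplexPoints (base W), Module.Finite ℚ (bettiCohomology (fiberOver π t) 2) :=
    fun t => finite (hπ.isSmoothProjective t) 2
  -- the real Hodge models of the fibres (so that `(Am t).hodgeStructure … 2 = hodge … 2` definitionally)
  let Am : ∀ t : ComplexPoints (base W), HodgeModel 2 (fiberOver π t) := fun t =>
    realHodgeModel exists_isReal_hodgeModel_holds (hπ.isSmoothProjective t)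
  have hAm : ∀ t, (Am t).IsHodgeSymmetric := fun t =>
    realHodgeModel_isHodgeSymmetric exists_isReal_hodgeModel_holds (hπ.isSmoothProjective t)
  have hirr : IrreducibleSpace (base W).left := by
    obtain ⟨t₀⟩ := hne
    haveI : IrreducibleSpace (Spec (CommRingCat.of (ParamRing e))) :=
      inferInstanceAs (IrreducibleSpace (PrimeSpectrum (ParamRing e)))
    change IrreducibleSpace W
    exact isIrreducible_iff_irreducibleSpace.mp ⟨⟨W.ι t₀.pt, by rw [← Scheme.Opens.range_ι]; exact ⟨t₀.pt, rfl⟩⟩,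
      (PreirreducibleSpace.isPreirreducible_univ (X := Spec (CommRingCat.of (ParamRing e)))).open_subset W.isOpen
        (Set.subset_univ _)⟩
  -- ### the Cattani–Deligne–Kaplan cover of the non-Hodge-generic points
  obtain ⟨Wbad, hWbad, hgen⟩ := hCDK π 2 2 hπ hqpW inferInstance hirr hU Am hAm
  -- ### the genericity polynomials (G7): complement of `W`, the CDK cover, the chart genericity element
  have hG : ∃ G : ℕ → MvPolynomial ({d : Fin 3 →₀ ℕ // d.degree = 1} ⊕ {d : Fin 3 →₀ ℕ // d.degree = e - 1}) ℂ,
      (∀ i, ∃ c ψ : MvPolynomial (Fin 3) ℂ, c.IsHomogeneous 1 ∧ ψ.IsHomogeneous (e - 1) ∧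
        MvPolynomial.rename (Equiv.swap (0 : Fin 3) 1) ψ = ψ ∧
        MvPolynomial.eval (Sum.elim (fun d => c.coeff d.1) (fun d => ψ.coeff d.1)) (G i) ≠ 0) ∧
      ∀ c ψ : MvPolynomial (Fin 3) ℂ, c.IsHomogeneous 1 → ψ.IsHomogeneous (e - 1) →
        MvPolynomial.rename (Equiv.swap (0 : Fin 3) 1) ψ = ψ →
        (∀ i, MvPolynomial.eval (Sum.elim (fun d => c.coeff d.1) (fun d => ψ.coeff d.1)) (G i) ≠ 0) →
        ∃ t : ComplexPoints (base W), cOf (coeffs W t) = c ∧ ψOf (coeffs W t) = ψ ∧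
          IsHodgeGenericPoint π 2 hU hπ Am hAm ⟨t, Set.mem_univ t⟩ ∧
          MvPolynomial.eval (coeffs W t) (genericityElem e) ≠ 0 := by
    -- G7: the coset device
    obtain ⟨G, hGne, hGpt⟩ := Q8SymplecticPowersGenericityPolynomials.exists_genericityPolynomials W hne Wbad hWbad
      (genericityElem e) (genericityElem_ne_zero e (by omega))
    refine ⟨G, hGne, fun c ψ hc hψ hψσ hGi => ?_⟩
    obtain ⟨t, htc, htψ, htbad, htG⟩ := hGpt c ψ hc hψ hψσ hGi
    refine ⟨t, htc, htψ, ?_, htG⟩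
    by_contra hng
    obtain ⟨j, hj⟩ := hgen ⟨t, Set.mem_univ t⟩ hng
    exact htbad j hj
  obtain ⟨G, hGne, hGpt⟩ := hG
  refine ⟨G, hGne, ?_⟩
  intro c ψ hc hψ hψσ hGi V X hX hV hbir τ' j' hb'
  obtain ⟨t, htc, htψ, hgen_t, hGe⟩ := hGpt c ψ hc hψ hψσ hGi
  -- ### the registered point data at `t`
  have h4t := h4all t
  have h5t6 := h5all t
  -- the S5 body at `t` in the `Mv`-currency of the restriction theorem (v6 → v5 glue: `Mv = ker(A²+1)` from (iv) + isometry)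
  have h5t : let Xs := fiberOver π t; let hXs : IsSmoothProjective 2 Xs := hπ.isSmoothProjective t; let A : bettiCohomology Xs 2 →ₗ[ℚ] bettiCohomology Xs 2 := pull (fiberOverEnd π τ hτπ t) 2; let B : bettiCohomology Xs 2 →ₗ[ℚ] bettiCohomology Xs 2 := pull (fiberOverEnd π j hjπ t) 2; let Qf : LinearMap.BilinForm ℚ (bettiCohomology Xs 2) := LinearMap.compr₂ (cup Xs 2 2) (tr hXs (2 + 2)); let Γ := ratMonodromyGroup π 2 hU ⟨t, Set.mem_univ t⟩; let N : Submodule ℚ (bettiCohomology Xs 2) := Submodule.span ℚ {x | ∃ Γ' : Subgroup (bettiCohomology Xs 2 ≃ₗ[ℚ] bettiCohomology Xs 2), Γ' ≤ Γ ∧ (Γ'.subgroupOf Γ).FiniteIndex ∧ ∀ γ ∈ Γ', γ x = x}; let Mv : Submodule ℚ (bettiCohomology Xs 2) := Module.End.eigenspace (A ^ 2) (-1) ⊓ Qf.orthogonal N; ∃ γ ∈ Γ, ∃ ℓp ℓm : TensorProduct ℚ ℂ (bettiCohomology Xs 2), ℓp ∈ Mv.baseChange ℂ ∧ ℓm ∈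 Mv.baseChange ℂ ∧ A.baseChange ℂ ℓp = Complex.I • ℓp ∧ A.baseChange ℂ ℓm = Complex.I • ℓm ∧ (Qf.baseChange ℂ) ℓp (B.baseChange ℂ ℓm) ≠ 0 ∧ (γ.toLinearMap.baseChange ℂ) ℓp = Complex.I • ℓp ∧ (γ.toLinearMap.baseChange ℂ) ℓm = (-Complex.I) • ℓm ∧ ∀ x ∈ Mv.baseChange ℂ, A.baseChange ℂ x = Complex.I • x → (Qf.baseChange ℂ) x (B.baseChange ℂ ℓp) = 0 → (Qf.baseChange ℂ) x (B.baseChange ℂ ℓm) = 0 → (γ.toLinearMap.baseChange ℂ) x = x := by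
    intro Xs hXs A B Qf Γ N Mv
    obtain ⟨-, ho', -, -, -, hiv⟩ := h4t
    have hpg : (hodge exists_isReal_hodgeModel_holds (hπ.isSmoothProjective t) 2).piece 2 0 ≠ ⊥ := by
      intro h0
      rw [h0, inf_bot_eq, finrank_bot] at ho'
      exact lt_irrefl 0 ho'
    obtain ⟨r1, -, -⟩ := quaternionRelations_pull_fiberOverEnd π hτπ hjπ hτ4 hj2 hτjτ t 2
    have hAQ := Q8SymplecticPowersDeckIsometry.tr_cup_pull_pull_of_pull_pow_eq_one (hπ.isSmoothProjective t)
      (fiberOverEnd π τ hτπ t) (by norm_num : 0 < 4) r1 hpg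
    have hMv : Mv = Module.End.eigenspace (A ^ 2) (-1) :=
      Q8SymplecticPowersStubTransportHeredityQ6.eigenspace_sq_neg_one_inf_orthogonal_eq A Qf
        (fun x y => (LinearMap.compr₂_apply _ _ _ _).trans ((hAQ x y).trans (LinearMap.compr₂_apply _ _ _ _).symm)) N hiv
    rw [hMv]
    exact h5t6
  have hXt : IsSmoothProjective 2 (fiberOver π t) := hπ.isSmoothProjective t
  -- ### DENSITY at `t` (restriction currency + G1–G5)
  have hDens : ∀ g : bettiCohomology (fiberOver π t) 2 ≃ₗ[ℚ] bettiCohomology (fiberOver π t) 2,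
      Uni (fiberOver π t) hXt (fiberOverEnd π τ hτπ t) (fiberOverEnd π j hjπ t) g →
        g ∈ glIdentityComponent (ratMonodromyGroup π 2 hU ⟨t, Set.mem_univ t⟩) := by
    intro g hg
    obtain ⟨hgA, hgB, hgQ, hgH⟩ := hg
    obtain ⟨ho, ho', hi, hii, hiii, -⟩ := h4t
    obtain ⟨r1, r2, r3⟩ := quaternionRelations_pull_fiberOverEnd π hτπ hjπ hτ4 hj2 hτjτ t 2
    -- `p_g(X_t) > 0` from (o′)
    have hpg : (hodge exists_isReal_hodgeModel_holds hXt 2).piece 2 0 ≠ ⊥ := by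
      intro h0
      rw [h0, inf_bot_eq, finrank_bot] at ho'
      exact lt_irrefl 0 ho'
    -- the deck maps are isometries of `Qf`
    have hj4 : pull (fiberOverEnd π j hjπ t) 2 ^ 4 = 1 := by
      rw [show (4 : ℕ) = 2 * 2 from rfl, pow_mul, r2, ← pow_mul]; exact r1
    have hAQ := Q8SymplecticPowersDeckIsometry.tr_cup_pull_pull_of_pull_pow_eq_one hXt (fiberOverEnd π τ hτπ t)
      (by norm_num : 0 < 4) r1 hpg
    have hBQ := Q8SymplecticPowersDeckIsometry.tr_cup_pull_pull_of_pull_pow_eq_one hXt (fiberOverEnd π j hjπ t)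
      (by norm_num : 0 < 4) hj4 hpg
    -- G3: the finite-orbit part consists of Hodge classes (fixed part on the finite étale cover, FACT B, + S4 (i))
    have hNsub : ∀ x ∈ Submodule.span ℚ {x : bettiCohomology (fiberOver π t) 2 |
        ∃ Γ' : Subgroup (bettiCohomology (fiberOver π t) 2 ≃ₗ[ℚ] bettiCohomology (fiberOver π t) 2),
          Γ' ≤ ratMonodromyGroup π 2 hU ⟨t, Set.mem_univ t⟩ ∧
          (Γ'.subgroupOf (ratMonodromyGroup π 2 hU ⟨t, Set.mem_univ t⟩)).FiniteIndex ∧ ∀ γ ∈ Γ', γ x = x},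
        x ∈ (hodge exists_isReal_hodgeModel_holds hXt 2).hodgeClasses 1 := fun x hx =>
      Q8SymplecticPowersFiniteOrbitPartHodge.span_finiteIndexFixed_le_hodgeClasses_one π hπ hqpW (Fintype.card (CIdx e)) hU t hDelB
        hi hx
    -- G4: FIN₊ — the `τ²`-invariant part has finite monodromy (S4 (o) + Deligne 1982 move (F))
    have hV : Module.End.eigenspace (pull (fiberOverEnd π τ hτπ t) 2 ^ 2) 1 ≤
        Submodule.span ℚ {x : bettiCohomology (fiberOver π t) 2 |
          ∃ Γ' : Subgroup (bettiCohomology (fiberOver π t) 2 ≃ₗ[ℚ] bettiCohomology (fiberOver π t) 2),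
            Γ' ≤ ratMonodromyGroup π 2 hU ⟨t, Set.mem_univ t⟩ ∧
            (Γ'.subgroupOf (ratMonodromyGroup π 2 hU ⟨t, Set.mem_univ t⟩)).FiniteIndex ∧ ∀ γ ∈ Γ', γ x = x} :=
      Q8SymplecticPowersInvariantPartFiniteOrbit.eigenspace_sq_le_span_finiteIndexFixed π hπ hqp hqpW (Fintype.card (CIdx e)) hU τ hτπ t
        (fun γ hγ x => Q8SymplecticPowersMonodromyDeckCommutes.apply_pull_fiberOverEnd_of_mem_ratMonodromyGroup π 2 hU τ hτπ t hγ x) ho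
    -- G5: `Qf|_N` is non-degenerate (Hodge–Riemann on the rational (1,1)-classes + the flat hyperplane class)
    have hNQ : ∀ x ∈ Submodule.span ℚ {x : bettiCohomology (fiberOver π t) 2 |
        ∃ Γ' : Subgroup (bettiCohomology (fiberOver π t) 2 ≃ₗ[ℚ] bettiCohomology (fiberOver π t) 2),
          Γ' ≤ ratMonodromyGroup π 2 hU ⟨t, Set.mem_univ t⟩ ∧
          (Γ'.subgroupOf (ratMonodromyGroup π 2 hU ⟨t, Set.mem_univ t⟩)).FiniteIndex ∧ ∀ γ ∈ Γ', γ x = x},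
        (∀ y ∈ Submodule.span ℚ {x : bettiCohomology (fiberOver π t) 2 |
          ∃ Γ' : Subgroup (bettiCohomology (fiberOver π t) 2 ≃ₗ[ℚ] bettiCohomology (fiberOver π t) 2),
            Γ' ≤ ratMonodromyGroup π 2 hU ⟨t, Set.mem_univ t⟩ ∧
            (Γ'.subgroupOf (ratMonodromyGroup π 2 hU ⟨t, Set.mem_univ t⟩)).FiniteIndex ∧ ∀ γ ∈ Γ', γ x = x},
          LinearMap.compr₂ (cup (fiberOver π t) 2 2) (tr hXt (2 + 2)) x y = 0) → x = 0 :=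
      Q8SymplecticPowersFiniteOrbitPartNondegenerate.tr_cup_nondegenerate_on_span_finiteIndexFixed π hπ hqp hqpW hU t hNsub
    exact Q8SymplecticPowersTransportRestrictionCurrency.mem_glIdentityComponent_of_variablePart h14 h14' h15 h141
      (Qf := LinearMap.compr₂ (cup (fiberOver π t) 2 2) (tr hXt (2 + 2)))
      (fun x y => by simp only [LinearMap.compr₂_apply]; rw [BettiUniverse.cup_comm_of_even (by decide)])
      (nondegenerate_tr_cup hXt) r1 r2 r3
      (fun x y => by simpa only [LinearMap.compr₂_apply] using hAQ x y)
      (fun x y => by simpa only [LinearMap.compr₂_apply] using hBQ x y)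
      (Γ := ratMonodromyGroup π 2 hU ⟨t, Set.mem_univ t⟩)
      (fun γ hγ x => Q8SymplecticPowersMonodromyDeckCommutes.apply_pull_fiberOverEnd_of_mem_ratMonodromyGroup π 2 hU τ hτπ t hγ x)
      (fun γ hγ x => Q8SymplecticPowersMonodromyDeckCommutes.apply_pull_fiberOverEnd_of_mem_ratMonodromyGroup π 2 hU j hjπ t hγ x)
      (fun γ hγ x y => by
        simpa only [LinearMap.compr₂_apply] using
          Q8SymplecticPowersMonodromyDeckCommutes.tr_cup_apply_apply_of_mem_ratMonodromyGroup π hπ hqp hqpW hU t hγ x y)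
      rfl hV hNQ rfl hii hiii h5t hgA hgB (fun x y => by simpa only [LinearMap.compr₂_apply] using hgQ x y)
      (fun x hx => hgH x (hNsub x hx))
  -- ### `Mon ⊆ MT` at the Hodge-generic point `t` (Deligne 1972 ∕ CMSP 15.3.7, tree theorem) and the K1 kernel ⇒ `Comm` at `t`
  have hMT : glIdentityComponent (ratMonodromyGroup π 2 hU ⟨t, Set.mem_univ t⟩) ⊆
      (((Am t).hodgeStructure hXt (hAm t) 2).mumfordTateGroup :
        Set (bettiCohomology (fiberOver π t) 2 ≃ₗ[ℚ] bettiCohomology (fiberOver π t) 2)) :=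
    (deligne_finiteIndex_monodromy_le_mumfordTateGroup_of_isQuasiProjectiveOver π 2 2 hπ hqp hqpW inferInstance hirr hU
      Am hAm ⟨t, Set.mem_univ t⟩ hgen_t).2
  have hCommt : Comm (fiberOver π t) hXt (fiberOverEnd π τ hτπ t) (fiberOverEnd π j hjπ t) := by
    refine Q8SymplecticPowersCommKernel.q8Comm_of_glIdentityComponent_subset_mumfordTateGroup π hU
      (fun s => hπ.isSmoothProjective s) Am hAm t hXt (Iso.refl _) _ _ hMT fun g hg => ?_
    have hid : (pullEquiv (Iso.refl (fiberOver π t)) 2).trans (g.trans (pullEquiv (Iso.refl (fiberOver π t)) 2).symm) = g := by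
      ext v
      simp only [LinearEquiv.trans_apply, pullEquiv_apply, pullEquiv_symm_apply, Iso.refl_inv, Iso.refl_hom, pull_id,
        LinearMap.id_apply]
    rw [hid]
    exact hDens g hg
  -- ### the deck-pair binders at `t` (relations: `quaternionRelations_pull_fiberOverEnd`; Hodge numbers: S4 (o)(o′))
  have hbind_t : pull (fiberOverEnd π τ hτπ t) 2 ^ 4 = 1 ∧
      pull (fiberOverEnd π j hjπ t) 2 ^ 2 = pull (fiberOverEnd π τ hτπ t) 2 ^ 2 ∧
      pull (fiberOverEnd π j hjπ t) 2 * pull (fiberOverEnd π τ hτπ t) 2 =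
        pull (fiberOverEnd π τ hτπ t) 2 ^ 3 * pull (fiberOverEnd π j hjπ t) 2 ∧
      Module.finrank ℂ ↥(Module.End.eigenspace ((pull (fiberOverEnd π τ hτπ t) 2 ^ 2).baseChange ℂ) 1 ⊓
        (hodge exists_isReal_hodgeModel_holds hXt 2).piece 2 0) = 0 ∧
      0 < Module.finrank ℂ ↥(Module.End.eigenspace ((pull (fiberOverEnd π τ hτπ t) 2 ^ 2).baseChange ℂ) (-1) ⊓
        (hodge exists_isReal_hodgeModel_holds hXt 2).piece 2 0) := by
    obtain ⟨r1, r2, r3⟩ := quaternionRelations_pull_fiberOverEnd π hτπ hjπ hτ4 hj2 hτjτ t 2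
    obtain ⟨ho, ho', -⟩ := h4t
    exact ⟨r1, r2, r3, ho, ho'⟩
  -- ### fibre identification (chart surjectivity + CHART-IN-COVER birationality) and S2
  have hbir_t : AlgebraicGeometry.Scheme.BirationalOver (fiberOver π t).hom X.hom := by
    have he1 : 1 ≤ e := by omega
    have hbV := Q8SymplecticPowersFibreBirational.birationalOver_fiberOver_of_deckClauses he1 W 𝒳 π ι hπ hιo hιπ hsurj t hGe
      (V := V) (by rw [htc, htψ]; exact hV)
    exact hbV.trans hbir.symm
  exact hS2 hXt hX hbir_t (fiberOverEnd π τ hτπ t) (fiberOverEnd π j hjπ t) τ' j' hbind_t hb' hCommt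

end Summit.HodgeConjecture.HodgeConjecture.Theorems.Q8SymplecticPowersStubTransportHeredityQ9
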